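import Literature.NumberTheory.Transcendental.BakerQuantObstruction
import Literature.NumberTheory.Transcendental.BakerQuantArith
import Mathlib.LinearAlgebra.Basis.VectorSpace
import HarnessLib

/-!
# Baker 1975, Ch. 3 — the degenerate obstruction: `Λ'` is `2πi` times a fixed rational form

Support for the proof of Theorem 3.1 of A. Baker, *Transcendental Number Theory* (1975), Ch. 3
(`Literature.NumberTheory.Transcendental.baker1975_thm_3_1`), zero-estimate line, sequel to
`BakerQuantObstruction.lean`. There the zero estimate left one configuration standing: `β₀ = 0`
and `b = (β₁, …, βₙ, -1) ∈ span_ℂ(torsChars)`, `torsChars = {χ ∈ ℤ^{n+1} ; ∑ χⱼ lⱼ ∈ 2πiℚ}`. This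
file disposes of it in the manner of Philippon–Waldschmidt (New Advances in Transcendence Theory,
1988, Ch. 18, Lemma 3.7: "`Λ = ∑ cⱼ 2πkⱼ√-1/s` … it is therefore sufficient to use Liouville's
inequality") and of the last lines of Baker's §4 (p. 37: "`b'₁ log α₁ + ⋯ + b'ₙ log αₙ = (2πi) jk` …
Hence we conclude that `j = 0`"), but WITHOUT any bound on the torsion characters involved:

* `exists_ratRetraction` — a `ℚ`-linear `π₀ : ℂ → ℚ` with `π₀(2πi q) = q` (extension of the
  coordinate of the `ℚ`-line `ℚ · 2πi`); `Setup.aQ j = π₀(lⱼ)` — FIXED rationals attached to the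
  logarithms — satisfy `∑ χⱼ lⱼ = 2πi ∑ aQⱼ χⱼ` for every torsion character (`sum_mul_l_of_torsChars`)
  and hence, by `ℂ`-linearity, `∑ xⱼ lⱼ = 2πi ∑ aQⱼ xⱼ` on all of `span_ℂ(torsChars)`
  (`sum_mul_l_of_mem_span`);
* consequently, in the degenerate configuration, `Λ' = 2πi · y` with
  `y = ∑ᵣ aQᵣ βᵣ - aQ_{n+1} ∈ K` (`Data.Λ'_eq_of_degenerate`);
* `Data.norm_Λ'_ge_of_degenerate` — **Liouville**: if moreover `Λ' ≠ 0` then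
  `|Λ'| ≥ (κ₁ · e^{(n+1) D₀ h})⁻¹` with `κ₁ = (N_a C_a)^{D₀} ≥ 1` a constant of the fixed data
  (`N_a` a common denominator and `C_a = 1 + ∑|aQⱼ|`), through the tree's
  `Baker1975.Ch3.liouville_lower_bound` (denominators `bⱼ ≤ eʰ`, conjugates `≤ eʰ` of the `βⱼ`).

Everything here is proved; no named facts.

## References

* A. Baker, *Transcendental Number Theory*, CUP 1975, Ch. 3 §4 (p. 37). [BakerTNT1975]
* P. Philippon, M. Waldschmidt, *Lower bounds for linear forms in logarithms*, New Advances in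
  Transcendence Theory (A. Baker, ed.), CUP 1988, Ch. 18, Lemma 3.7.
-/

noncomputable section

open Complex Finset

namespace Literature.NumberTheory.Transcendental.Baker1975.Ch3

/-! ### A `ℚ`-linear retraction of `ℂ` onto the line `ℚ · 2πi` -/

/-- `2πi ≠ 0`. [folklore] -/
theorem two_pi_I_ne_zero' : (2 * Real.pi * I : ℂ) ≠ 0 := by
  simp [Real.pi_ne_zero, I_ne_zero]

/-- **A `ℚ`-linear map `π₀ : ℂ → ℚ` with `π₀(q · 2πi) = q`** (extend the coordinate functional of the
`ℚ`-line spanned by `2πi` to the `ℚ`-vector space `ℂ`). [folklore] -/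
theorem exists_ratRetraction : ∃ π₀ : ℂ →ₗ[ℚ] ℚ, ∀ q : ℚ, π₀ ((q : ℂ) * (2 * Real.pi * I)) = q := by
  set x : ℂ := 2 * Real.pi * I with hx
  have h0 : x ≠ 0 := two_pi_I_ne_zero'
  obtain ⟨g, hg⟩ := LinearMap.exists_extend (LinearEquiv.coord ℚ ℂ x h0).toLinearMap
  refine ⟨g, fun q => ?_⟩
  have hmem : (q : ℂ) * x ∈ (ℚ ∙ x) := by
    rw [← Rat.smul_def]
    exact Submodule.smul_mem _ _ (Submodule.mem_span_singleton_self x)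
  have h1 : g ((q : ℂ) * x) = LinearEquiv.coord ℚ ℂ x h0 ⟨(q : ℂ) * x, hmem⟩ := by
    have := LinearMap.congr_fun hg ⟨(q : ℂ) * x, hmem⟩
    simpa using this
  rw [h1]
  have h2 := LinearEquiv.coord_apply_smul ℚ ℂ x h0 ⟨(q : ℂ) * x, hmem⟩
  -- `coord y • x = y = q • x`
  have h3 : (LinearEquiv.coord ℚ ℂ x h0 ⟨(q : ℂ) * x, hmem⟩) • x = q • x := by
    rw [h2, Rat.smul_def]
  exact smul_left_injective ℚ h0 h3

/-- A fixed `ℚ`-linear retraction `π₀ : ℂ → ℚ`, `π₀(q · 2πi) = q`. [folklore] -/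
def ratRetraction : ℂ →ₗ[ℚ] ℚ := Classical.choose exists_ratRetraction

/-- `π₀(q · 2πi) = q`. [folklore] -/
theorem ratRetraction_apply (q : ℚ) : ratRetraction ((q : ℂ) * (2 * Real.pi * I)) = q :=
  Classical.choose_spec exists_ratRetraction q

namespace Setup

variable (S : Setup)

/-- **The fixed rationals `aQⱼ = π₀(lⱼ)`** attached to the logarithms. [folklore] -/
def aQ (j : Fin (S.n + 1)) : ℚ := ratRetraction (S.l j)

/-- **On torsion characters the logarithmic form is `2πi` times the rational form**:
`∑ χⱼ lⱼ = 2πi ∑ aQⱼ χⱼ` for `χ ∈ torsChars`. [cite: BakerTNT1975, Ch. 3 §4 (p. 37)] -/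
theorem sum_mul_l_of_torsChars {χ : Fin (S.n + 1) → ℤ} (hχ : χ ∈ S.torsChars) :
    ∑ j, (χ j : ℂ) * S.l j = 2 * Real.pi * I * ∑ j, (S.aQ j : ℂ) * (χ j : ℂ) := by
  obtain ⟨q, hq⟩ := hχ
  -- apply `π₀` to `∑ χⱼ lⱼ = q · 2πi`
  have h1 : ratRetraction (∑ j, (χ j : ℂ) * S.l j) = ∑ j, (χ j : ℚ) * S.aQ j := by
    rw [map_sum]
    refine Finset.sum_congr rfl fun j _ => ?_
    have : (χ j : ℂ) * S.l j = ((χ j : ℚ)) • S.l j := by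
      rw [Rat.smul_def]; push_cast; rfl
    rw [this, LinearMap.map_smul, smul_eq_mul, aQ]
  have h2 : ratRetraction (∑ j, (χ j : ℂ) * S.l j) = q := by
    rw [hq, mul_comm, ratRetraction_apply]
  have hq' : (q : ℂ) = ∑ j, (S.aQ j : ℂ) * (χ j : ℂ) := by
    rw [← h2, h1]
    push_cast
    exact Finset.sum_congr rfl fun j _ => by ring
  rw [hq, hq']

/-- **`ℂ`-linear extension**: `∑ xⱼ lⱼ = 2πi ∑ aQⱼ xⱼ` for every `x ∈ span_ℂ(torsChars)`. [folklore] -/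
theorem sum_mul_l_of_mem_span {x : Fin (S.n + 1) → ℂ}
    (hx : x ∈ Submodule.span ℂ ((fun χ : Fin (S.n + 1) → ℤ => fun j => (χ j : ℂ)) '' S.torsChars)) :
    ∑ j, x j * S.l j = 2 * Real.pi * I * ∑ j, (S.aQ j : ℂ) * x j := by
  induction hx using Submodule.span_induction with
  | mem x hx =>
    obtain ⟨χ, hχ, rfl⟩ := hx
    exact S.sum_mul_l_of_torsChars hχ
  | zero => simp
  | add x y _ _ hx hy =>
    simp only [Pi.add_apply, add_mul, Finset.sum_add_distrib, hx, hy, mul_add]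
  | smul c x _ hx =>
    simp only [Pi.smul_apply, smul_eq_mul]
    have h1 : ∑ j, c * x j * S.l j = c * ∑ j, x j * S.l j := by
      rw [Finset.mul_sum]; exact Finset.sum_congr rfl fun j _ => by ring
    rw [h1, hx, Finset.mul_sum, Finset.mul_sum, Finset.mul_sum]
    exact Finset.sum_congr rfl fun j _ => by ring

/-- A common denominator `N_a = ∏ⱼ den(aQⱼ) ≥ 1` of the fixed rationals. [folklore] -/
def aDen : ℕ := ∏ j, (S.aQ j).den

/-- `1 ≤ N_a`. [folklore] -/
theorem one_le_aDen : 1 ≤ S.aDen :=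
  Nat.succ_le_of_lt (Finset.prod_pos fun j _ => (S.aQ j).den_pos)

/-- The numerators `Aⱼ = aQⱼ · N_a ∈ ℤ`. [folklore] -/
def aNum (j : Fin (S.n + 1)) : ℤ := (S.aQ j).num * ∏ j' ∈ Finset.univ.erase j, ((S.aQ j').den : ℤ)

/-- `aQⱼ · N_a = Aⱼ`. [folklore] -/
theorem aQ_mul_aDen (j : Fin (S.n + 1)) : (S.aQ j : ℚ) * (S.aDen : ℚ) = (S.aNum j : ℚ) := by
  classical
  unfold aDen aNum
  rw [← Finset.mul_prod_erase Finset.univ (fun j' => (S.aQ j').den) (Finset.mem_univ j)]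
  push_cast
  rw [← mul_assoc, Rat.mul_den_eq_num]

/-- The size constant `C_a = 1 + ∑ⱼ |aQⱼ| ≥ 1`. [folklore] -/
def aSize : ℝ := 1 + ∑ j, |(S.aQ j : ℝ)|

/-- `1 ≤ C_a`. [folklore] -/
theorem one_le_aSize : 1 ≤ S.aSize := by
  have : 0 ≤ ∑ j, |(S.aQ j : ℝ)| := Finset.sum_nonneg fun j _ => abs_nonneg _
  unfold aSize; linarith

/-- **The Liouville constant of the degenerate case**: `κ₁ = (N_a C_a)^{D₀}`. [folklore] -/
def κ₁ : ℝ := ((S.aDen : ℝ) * S.aSize) ^ S.D₀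

/-- `1 ≤ κ₁`. [folklore] -/
theorem one_le_κ₁ : 1 ≤ S.κ₁ := by
  unfold κ₁
  refine one_le_pow₀ ?_
  have h1 : (1 : ℝ) ≤ S.aDen := by exact_mod_cast S.one_le_aDen
  nlinarith [S.one_le_aSize]

end Setup

/-- Integer casts are integral over `ℤ`. [folklore] -/
theorem isIntegral_intCast' {A : Type*} [Ring A] (z : ℤ) : IsIntegral ℤ (z : A) := by
  simpa using isIntegral_algebraMap (R := ℤ) (A := A) (x := z)

/-- Natural number casts are integral over `ℤ`. [folklore] -/
theorem isIntegral_natCast' {A : Type*} [Ring A] (n : ℕ) : IsIntegral ℤ (n : A) := by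
  simpa using isIntegral_algebraMap (R := ℤ) (A := A) (x := (n : ℤ))

namespace Data

variable {S : Setup} (D : Data S)

/-- **The rational form of the coefficients**: `y = ∑ᵣ aQᵣ βᵣ - aQ_{n+1} ∈ K`. [folklore] -/
def yK : D.K := ∑ r : Fin S.n, (S.aQ (Fin.castSucc r) : D.K) * D.βv (some r) - (S.aQ (Fin.last S.n) : D.K)

/-- `y` as a complex number: `∑ⱼ aQⱼ bⱼ`. [folklore] -/
theorem coe_yK : (D.yK : ℂ) = ∑ j, (S.aQ j : ℂ) * D.bvec j := by
  rw [yK, Fin.sum_univ_castSucc]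
  simp only [bvec_castSucc, bvec_last, mul_neg, mul_one]
  push_cast
  simp only [β, sub_eq_add_neg]

/-- **In the degenerate configuration `Λ' = 2πi · y`.** [cite: BakerTNT1975, Ch. 3 §4 (p. 37)] -/
theorem Λ'_eq_of_degenerate (hβ₀ : D.β₀ = 0)
    (hb : D.bvec ∈ Submodule.span ℂ ((fun χ : Fin (S.n + 1) → ℤ => fun j => (χ j : ℂ)) '' S.torsChars)) :
    D.Λ' = 2 * Real.pi * I * (D.yK : ℂ) := by
  rw [D.Λ'_eq_β₀_add_sum, hβ₀, zero_add, S.sum_mul_l_of_mem_span hb, coe_yK]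

/-- A denominator for `y`: `b = N_a ∏ᵣ b_r` makes `b y` an algebraic integer. [folklore] -/
theorem isIntegral_den_mul_yK :
    IsIntegral ℤ (((S.aDen * ∏ r : Fin S.n, D.bden (some r) : ℕ) : D.K) * D.yK) := by
  classical
  -- `N_a aQⱼ = Aⱼ` inside `K`
  have hA : ∀ j, ((S.aDen : ℕ) : D.K) * (S.aQ j : D.K) = ((S.aNum j : ℤ) : D.K) := by
    intro j
    have h := S.aQ_mul_aDen j
    have h' : ((S.aQ j * (S.aDen : ℚ) : ℚ) : D.K) = ((S.aNum j : ℚ) : D.K) := by rw [h]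
    push_cast at h'
    rw [mul_comm]; exact h'
  -- `∏ b_{r'} = b_r ∏_{r' ≠ r} b_{r'}`
  have hprod : ∀ r : Fin S.n, ((∏ r' : Fin S.n, D.bden (some r') : ℕ) : D.K) =
      (D.bden (some r) : D.K) * ((∏ r' ∈ Finset.univ.erase r, D.bden (some r') : ℕ) : D.K) := by
    intro r
    rw [← Finset.mul_prod_erase Finset.univ (fun r' => D.bden (some r')) (Finset.mem_univ r)]
    push_cast; ring
  have hexp : ((S.aDen * ∏ r : Fin S.n, D.bden (some r) : ℕ) : D.K) * D.yK =
      ∑ r : Fin S.n, ((S.aNum (Fin.castSucc r) : ℤ) : D.K) *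
          ((∏ r' ∈ Finset.univ.erase r, D.bden (some r') : ℕ) : D.K) *
          ((D.bden (some r) : D.K) * D.βv (some r)) -
        ((S.aNum (Fin.last S.n) : ℤ) : D.K) * ((∏ r' : Fin S.n, D.bden (some r') : ℕ) : D.K) := by
    rw [yK, mul_sub, Finset.mul_sum]
    congr 1
    · refine Finset.sum_congr rfl fun r _ => ?_
      rw [Nat.cast_mul, hprod r, ← hA]
      ring
    · rw [Nat.cast_mul, ← hA]
      ring
  rw [hexp]
  refine IsIntegral.sub (IsIntegral.sum _ fun r _ => ?_) ?_
  · exact ((isIntegral_intCast' _).mul (isIntegral_natCast' _)).mul (D.isIntegral_bden (some r))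
  · exact (isIntegral_intCast' _).mul (isIntegral_natCast' _)

/-- Conjugates of `y`: `|φ y| ≤ C_a eʰ`. [folklore] -/
theorem norm_emb_yK_le (φ : D.K →+* ℂ) : ‖φ D.yK‖ ≤ S.aSize * Real.exp D.h := by
  rw [yK, map_sub, map_sum]
  have h1 : ‖∑ r : Fin S.n, φ ((S.aQ (Fin.castSucc r) : D.K) * D.βv (some r))‖ ≤
      (∑ r : Fin S.n, |(S.aQ (Fin.castSucc r) : ℝ)|) * Real.exp D.h := by
    rw [Finset.sum_mul]
    refine (norm_sum_le _ _).trans (Finset.sum_le_sum fun r _ => ?_)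
    rw [map_mul, map_ratCast, norm_mul, Complex.norm_ratCast]
    exact mul_le_mul_of_nonneg_left (D.norm_emb_le φ (some r)) (abs_nonneg _)
  have h2 : ‖φ (S.aQ (Fin.last S.n) : D.K)‖ = |(S.aQ (Fin.last S.n) : ℝ)| := by
    rw [map_ratCast, Complex.norm_ratCast]
  have h3 : ∑ r : Fin S.n, |(S.aQ (Fin.castSucc r) : ℝ)| + |(S.aQ (Fin.last S.n) : ℝ)| =
      ∑ j, |(S.aQ j : ℝ)| := by rw [Fin.sum_univ_castSucc]
  have hexp := D.one_le_exp_h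
  calc ‖∑ r : Fin S.n, φ ((S.aQ (Fin.castSucc r) : D.K) * D.βv (some r)) - φ (S.aQ (Fin.last S.n) : D.K)‖
      ≤ ‖∑ r : Fin S.n, φ ((S.aQ (Fin.castSucc r) : D.K) * D.βv (some r))‖ +
          ‖φ (S.aQ (Fin.last S.n) : D.K)‖ := norm_sub_le _ _
    _ ≤ (∑ r : Fin S.n, |(S.aQ (Fin.castSucc r) : ℝ)|) * Real.exp D.h +
          |(S.aQ (Fin.last S.n) : ℝ)| * Real.exp D.h := by
        rw [h2]
        refine add_le_add h1 ?_
        exact le_mul_of_one_le_right (abs_nonneg _) hexp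
    _ = (∑ j, |(S.aQ j : ℝ)|) * Real.exp D.h := by rw [← add_mul, h3]
    _ ≤ S.aSize * Real.exp D.h := by
        refine mul_le_mul_of_nonneg_right ?_ (Real.exp_pos _).le
        unfold Setup.aSize; linarith

/-- **Liouville in the degenerate configuration**: if `β₀ = 0`, `b ∈ span_ℂ(torsChars)` and
`Λ' ≠ 0`, then `|Λ'| ≥ (κ₁ e^{(n+1) D₀ h})⁻¹`. [cite: BakerTNT1975, Ch. 3 §4 (p. 37)] -/
theorem norm_Λ'_ge_of_degenerate (hβ₀ : D.β₀ = 0)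
    (hb : D.bvec ∈ Submodule.span ℂ ((fun χ : Fin (S.n + 1) → ℤ => fun j => (χ j : ℂ)) '' S.torsChars))
    (hΛ : D.Λ' ≠ 0) :
    (S.κ₁ * Real.exp (((S.n + 1) * S.D₀ : ℕ) * D.h))⁻¹ ≤ ‖D.Λ'‖ := by
  classical
  have hΛ' := D.Λ'_eq_of_degenerate hβ₀ hb
  have hy0 : D.yK ≠ 0 := by
    intro h0
    apply hΛ
    rw [hΛ', h0]
    simp
  -- the data of Liouville's inequality
  set b : ℕ := S.aDen * ∏ r : Fin S.n, D.bden (some r) with hbdef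
  have hb1 : 1 ≤ b := Nat.mul_pos S.one_le_aDen (Finset.prod_pos fun r _ => D.one_le_bden (some r))
  have hint : IsIntegral ℤ ((b : D.K) * D.yK) := D.isIntegral_den_mul_yK
  set M : ℝ := S.aSize * Real.exp D.h with hMdef
  have hM1 : 1 ≤ M := one_le_mul_of_one_le_of_one_le S.one_le_aSize D.one_le_exp_h
  have hM : ∀ φ : D.K →+* ℂ, ‖φ D.yK‖ ≤ M := D.norm_emb_yK_le
  have hL := liouville_lower_bound (algebraMap D.K ℂ) hy0 hb1 hint hM1 hM
  -- sizes: `b ≤ N_a e^{n h}`, `M = C_a e^h`, `[K:ℚ] ≤ D₀`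
  set Dk := Module.finrank ℚ D.K with hDk
  have hDk : Dk ≤ S.D₀ := D.finrank_le
  have hb_le : (b : ℝ) ≤ S.aDen * Real.exp D.h ^ S.n := by
    rw [hbdef, Nat.cast_mul, Nat.cast_prod]
    refine mul_le_mul_of_nonneg_left ?_ (Nat.cast_nonneg _)
    calc ∏ r : Fin S.n, (D.bden (some r) : ℝ) ≤ ∏ _r : Fin S.n, Real.exp D.h :=
          Finset.prod_le_prod (fun r _ => Nat.cast_nonneg _) fun r _ => D.bden_le (some r)
      _ = Real.exp D.h ^ S.n := by simp
  have hb0 : (1 : ℝ) ≤ b := by exact_mod_cast hb1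
  have hbase : (b : ℝ) ^ Dk * M ^ (Dk - 1) ≤ S.κ₁ * Real.exp (((S.n + 1) * S.D₀ : ℕ) * D.h) := by
    have he := D.one_le_exp_h
    have hden : (1 : ℝ) ≤ S.aDen := by exact_mod_cast S.one_le_aDen
    calc (b : ℝ) ^ Dk * M ^ (Dk - 1) ≤ (b : ℝ) ^ S.D₀ * M ^ S.D₀ :=
          mul_le_mul (pow_le_pow_right₀ hb0 hDk) (pow_le_pow_right₀ hM1 (by omega)) (by positivity)
            (by positivity)
      _ ≤ (S.aDen * Real.exp D.h ^ S.n) ^ S.D₀ * (S.aSize * Real.exp D.h) ^ S.D₀ := by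
          gcongr
      _ = S.κ₁ * Real.exp (((S.n + 1) * S.D₀ : ℕ) * D.h) := by
          rw [Real.exp_nat_mul, Setup.κ₁]; ring
  have hpos : 0 < (b : ℝ) ^ Dk * M ^ (Dk - 1) := by positivity
  calc (S.κ₁ * Real.exp (((S.n + 1) * S.D₀ : ℕ) * D.h))⁻¹ ≤ ((b : ℝ) ^ Dk * M ^ (Dk - 1))⁻¹ :=
        inv_anti₀ hpos hbase
    _ ≤ ‖algebraMap D.K ℂ D.yK‖ := hL
    _ = ‖(D.yK : ℂ)‖ := rfl
    _ ≤ ‖D.Λ'‖ := by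
        rw [hΛ', norm_mul]
        refine le_mul_of_one_le_left (norm_nonneg _) ?_
        rw [show (2 * (Real.pi : ℂ) * I) = ((2 * Real.pi : ℝ) : ℂ) * I by push_cast; ring, norm_mul,
          Complex.norm_real, Complex.norm_I, mul_one, Real.norm_eq_abs, abs_of_pos Real.two_pi_pos]
        linarith [Real.pi_gt_three]

end Data

end Literature.NumberTheory.Transcendental.Baker1975.Ch3
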